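import Summits.QuantumFields.YangMills.Theorems.UnitScaleTiltProp7HermiteCornerBlendTorus
import Summits.QuantumFields.YangMills.Theorems.UnitScaleTiltProp7HermiteProfile
import Summits.QuantumFields.YangMills.Theorems.UnitScaleTiltProp7CentreBiharmonicDirichlet
import Summits.QuantumFields.YangMills.Theorems.UnitScaleTiltProp7PinnedFlatComponent
import HarnessLib

/-!
# Route `UnitScaleTilt`, crux K1 «MinimiserStabilityRegPr» (stmt-QuantumFields-19200), route-R E′ path (α′), row LEMMA-H-CURVED — FILE 5b (T³ letters):
# LEMMA-H-CURVED FROM FRAME ROWS AND A DATA ROW — the Hermite corner blend at an `SU(2)` background on the T³ carrier, fed into the biharmonic Dirichlet principle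

Cell `ym3-torus`, D-0154 (3c) twin-width seat `ym-routeR-w1` (gen 5); row "routeR-w1 g5: LEMMA-H-CURVED" (namer ★ym-ust-19200-p1 g14, 2026-08-28 17:33Z; design of record
(x2′-corner), contract v2 18:49Z).  THEOREMS ONLY (0 `def`, 0 `sorry`); `--supports stmt-QuantumFields-19200`, count-neutral.  YM₃ on T³ is a ladder rung (R3), not the
Clay problem; nothing here claims a stub, the crux, d = 4 or the mass gap.

WHAT.  The chain F-H1 (✓ `Prop7CentreBiharmonicDirichlet.lap_energy_le_of_extension_T3`) ∘ F-H5a (✓ `Prop7HermiteCornerBlendTorus.exists_extension_lap_energy_le`) ∘ F-H2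
(✓ `Prop7HermiteProfile`, the seven profile rows) in the door's letters: run `K`, comparison height `n` (`ℓ = L^(K−n) ≥ 2`), `SU(2)` background `W` read through
`unitsField (toUField W)` (bi-contractive in the `L²`-operator norm, §1), `𝔸 = M₂(ℂ)`.  ★★★ `lemmaH_curved_of_rows`: if `Δ_W(Δ_Wψ) = 0` off the `(K−n)`-centres then
  `L^(K−n)·Σ_x ‖Δ_Wψ(x)‖²_HS ≤ L^(K−n)·2·{[3(2d(a₁+2a₀²))²ℓ^d + 48d²a₀²(6∕ℓ)((6∕ℓ)ℓ^d)]·Σ_y ‖ψ(embIter y) − c_y‖² + 3d²(24∕ℓ²)((24∕ℓ²)ℓ^d)·Σ_y G_y²}`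
for ANY bi-contractive corner frames `Fr_y` normalised at their centres with holonomy rows `a₀`, `a₁` near the centre (support predicate of F-H5a), ANY central `c_y`, and ANY
data row `‖R(Fr_y z)ψ(embIter y) − Z_μ(z)‖ ≤ G_y` there.  With `d = 3`, `a₀ ≈ e∕ℓ`, `a₁ ≈ e∕ℓ²` ((3.35) cube gauges, routeR-w4's `Prop7ConjFrameReg335`) the first bracket is
`O(e²)·ℓ^(3−4)`, so after the factor `L^(K−n) = ℓ` the right side is `k`-UNIFORM: `O(e²)·Σ_y‖ψ̊(embIter y)‖² + O(1)·ℓ^(−3)… ·Σ_y G_y²` — contract v2's shape.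

HOW.  §1 the profile rows for `p(r) = (1 − r∕ℓ)²(1 + 2r∕ℓ)` (casts + ✓ `Prop7HermiteProfile`) and the bi-contraction of `unitsField (toUField W)` (C⋆-norm of a unitary);
§2 the assembly: Frobenius ≤ `2·`operator² (✓ `Prop7PinnedFlatCoercivity.sum_normSq_le_mul_opNorm_sq`), F-H5a's extension, F-H1.
HONEST SCOPE.  The frame rows and the data row are hypotheses (their suppliers are named above); nothing of Bałaban's is asserted; no stub∕crux∕rung statement is proved here.

References: T. Bałaban, CMP 99 (1985) 389–434 [Balaban1985BackgroundPropagators] ((3.3)-(3.4) pp.390-391, (3.35) p.396, Thm 3.11 p.416); CMP 95 (1984) 17–40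
[Balaban1984PropagatorsI] ((1.29)-(1.31) p.23); CMP 102 (1985) 277–309 [Balaban1985Variational] (Prop. 7 p.299).
-/

set_option autoImplicit false

noncomputable section

open scoped BigOperators Matrix.Norms.L2Operator Matrix

namespace Summit.QuantumFields.YangMills.Theorems.Prop7LemmaHCurvedOfRows

open Literature.MathematicalPhysics.QuantumFieldTheory.Balaban1983to89
open Literature.MathematicalPhysics.QuantumFieldTheory.Balaban1983to89.T3ContinuumYM3Torus
open B9Eq39Adjoint (R covD divB)
open B9TorusCalculus (torusT)
open B10Eq27TorusAxialLog (unitsField toUField)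
open B5Eq118OneStroke (iterBlockOf)
open B15DeterminingSets (embIter)
open Summit.QuantumFields.YangMills.Theorems.Prop7HermiteProfile (hermite_zero hermite_self hermite_nonneg hermite_le_one hermite_pred hermite_one hermite_pred_le
  abs_hermite_secondDiff_le abs_hermite_sub_hermite_le)
open Summit.QuantumFields.YangMills.Theorems.Prop7CovHodgeSplit (unitsField_toUField_mem_unitary)
open Summit.QuantumFields.YangMills.Theorems.Prop7PinnedFlatCoercivity (sum_normSq_le_mul_opNorm_sq)
open Summit.QuantumFields.YangMills.Theorems.Prop7CentreBiharmonicDirichlet (lap_energy_le_of_extension_T3)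
open Summit.QuantumFields.YangMills.Theorems.Prop7HermiteCornerBlendTorus (exists_extension_lap_energy_le)

/-! ## §1 The profile rows and the bi-contraction of the background -/

section Profile

variable {P : Params} {k : ℕ}

/-- the seven displayed rows of the Hermite profile `p(r) = (1 − r∕ℓ)²(1 + 2r∕ℓ)`, `ℓ = L^k ≥ 2`, as a function `ℕ → ℝ`. [cite: Balaban1984PropagatorsI, (1.29)-(1.31) p.23] -/
theorem profile_rows (hℓ2 : 2 ≤ P.L ^ k) :
    (fun r : ℕ => (1 - (r : ℝ) / (((P.L ^ k : ℕ) : ℝ))) ^ 2 * (1 + 2 * (r : ℝ) / (((P.L ^ k : ℕ) : ℝ)))) 0 = 1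
    ∧ (fun r : ℕ => (1 - (r : ℝ) / (((P.L ^ k : ℕ) : ℝ))) ^ 2 * (1 + 2 * (r : ℝ) / (((P.L ^ k : ℕ) : ℝ)))) (P.L ^ k) = 0
    ∧ (∀ r : ℕ, r < P.L ^ k → 0 ≤ (fun r : ℕ => (1 - (r : ℝ) / (((P.L ^ k : ℕ) : ℝ))) ^ 2 * (1 + 2 * (r : ℝ) / (((P.L ^ k : ℕ) : ℝ)))) r
        ∧ (fun r : ℕ => (1 - (r : ℝ) / (((P.L ^ k : ℕ) : ℝ))) ^ 2 * (1 + 2 * (r : ℝ) / (((P.L ^ k : ℕ) : ℝ)))) r ≤ 1)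
    ∧ (∀ r : ℕ, r + 1 ≤ P.L ^ k → |(fun r : ℕ => (1 - (r : ℝ) / (((P.L ^ k : ℕ) : ℝ))) ^ 2 * (1 + 2 * (r : ℝ) / (((P.L ^ k : ℕ) : ℝ)))) (r + 1)
        - (fun r : ℕ => (1 - (r : ℝ) / (((P.L ^ k : ℕ) : ℝ))) ^ 2 * (1 + 2 * (r : ℝ) / (((P.L ^ k : ℕ) : ℝ)))) r| ≤ 3 / (((P.L ^ k : ℕ) : ℝ)))
    ∧ (∀ r : ℕ, 1 ≤ r → r + 1 ≤ P.L ^ k → |(fun r : ℕ => (1 - (r : ℝ) / (((P.L ^ k : ℕ) : ℝ))) ^ 2 * (1 + 2 * (r : ℝ) / (((P.L ^ k : ℕ) : ℝ)))) (r + 1)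
        - 2 * (fun r : ℕ => (1 - (r : ℝ) / (((P.L ^ k : ℕ) : ℝ))) ^ 2 * (1 + 2 * (r : ℝ) / (((P.L ^ k : ℕ) : ℝ)))) r
        + (fun r : ℕ => (1 - (r : ℝ) / (((P.L ^ k : ℕ) : ℝ))) ^ 2 * (1 + 2 * (r : ℝ) / (((P.L ^ k : ℕ) : ℝ)))) (r - 1)| ≤ 6 / (((P.L ^ k : ℕ) : ℝ)) ^ 2)
    ∧ (fun r : ℕ => (1 - (r : ℝ) / (((P.L ^ k : ℕ) : ℝ))) ^ 2 * (1 + 2 * (r : ℝ) / (((P.L ^ k : ℕ) : ℝ)))) 1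
        + (fun r : ℕ => (1 - (r : ℝ) / (((P.L ^ k : ℕ) : ℝ))) ^ 2 * (1 + 2 * (r : ℝ) / (((P.L ^ k : ℕ) : ℝ)))) (P.L ^ k - 1) = 1
    ∧ (fun r : ℕ => (1 - (r : ℝ) / (((P.L ^ k : ℕ) : ℝ))) ^ 2 * (1 + 2 * (r : ℝ) / (((P.L ^ k : ℕ) : ℝ)))) (P.L ^ k - 1) ≤ 3 / (((P.L ^ k : ℕ) : ℝ)) ^ 2 := by
  have hℓR2 : (2 : ℝ) ≤ (((P.L ^ k : ℕ) : ℝ)) := by exact_mod_cast hℓ2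
  have hℓR1 : (1 : ℝ) ≤ (((P.L ^ k : ℕ) : ℝ)) := by linarith
  have hℓR0 : (0 : ℝ) < (((P.L ^ k : ℕ) : ℝ)) := by linarith
  have h1ℓ : 1 ≤ P.L ^ k := by omega
  have hcast : (((P.L ^ k - 1 : ℕ)) : ℝ) = (((P.L ^ k : ℕ) : ℝ)) - 1 := by rw [Nat.cast_sub h1ℓ, Nat.cast_one]
  simp only []
  refine ⟨?_, hermite_self hℓR0.ne', fun r hr => ⟨hermite_nonneg hℓR0 (Nat.cast_nonneg r), hermite_le_one hℓR0 (by exact_mod_cast hr.le)⟩,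
    fun r hr => ?_, fun r h1 hr => ?_, ?_, ?_⟩
  · rw [Nat.cast_zero]; exact hermite_zero _
  · rw [Nat.cast_add, Nat.cast_one]
    exact abs_hermite_sub_hermite_le hℓR2 (Nat.cast_nonneg r) (by exact_mod_cast hr)
  · rw [Nat.cast_add, Nat.cast_one, Nat.cast_sub h1, Nat.cast_one]
    exact abs_hermite_secondDiff_le hℓR0 (Nat.cast_nonneg r) (by have : ((r : ℕ) : ℝ) + 1 ≤ (((P.L ^ k : ℕ) : ℝ)) := (by exact_mod_cast hr); linarith)
  · rw [Nat.cast_one, hcast, hermite_one hℓR0.ne', hermite_pred hℓR0.ne']; ring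
  · rw [hcast, hermite_pred hℓR0.ne']; exact hermite_pred_le hℓR1

/-- a unit whose value is unitary is bi-contractive in a C⋆-norm: `‖u‖ ≤ 1 ∧ ‖u⁻¹‖ ≤ 1`. [folklore] -/
theorem bicontr_of_mem_unitary {𝔸 : Type*} [NormedRing 𝔸] [StarRing 𝔸] [CStarRing 𝔸] [Nontrivial 𝔸] (u : 𝔸ˣ) (hu : (u : 𝔸) ∈ unitary 𝔸) :
    ‖(u : 𝔸)‖ ≤ 1 ∧ ‖((u⁻¹ : 𝔸ˣ) : 𝔸)‖ ≤ 1 := by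
  have hinv : ((u⁻¹ : 𝔸ˣ) : 𝔸) = star (u : 𝔸) := Units.inv_eq_of_mul_eq_one_left (Unitary.star_mul_self_of_mem hu)
  refine ⟨(CStarRing.norm_of_mem_unitary hu).le, ?_⟩
  rw [hinv]
  exact (CStarRing.norm_of_mem_unitary (Unitary.star_mem hu)).le

end Profile

/-! ## §2 LEMMA-H-curved from frame rows and a data row -/

section Assembly

/-- ★★★ **LEMMA-H-CURVED FROM FRAME ROWS AND A DATA ROW** (T³ letters; see the module docstring for the reading and the `k`-uniformity count).
[cite: Balaban1985BackgroundPropagators, (3.3)-(3.4) pp.390-391, (3.35) p.396, Thm 3.11 p.416; Balaban1984PropagatorsI, (1.29)-(1.31) p.23; Balaban1985Variational, Prop. 7 p.299] -/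
theorem lemmaH_curved_of_rows (F : T3Family) (K n : ℕ) (hk : K - n ≤ (F.P K).m + (F.P K).K) (hℓ2 : 2 ≤ (F.P K).L ^ (K - n))
    (W : GaugeField (F.P K) 0 (Matrix.specialUnitaryGroup (Fin 2) ℂ)) (ψ : Site (F.P K) 0 → Matrix (Fin 2) (Fin 2) ℂ)
    (hψ : ∀ x : Site (F.P K) 0, x ∉ Set.range (embIter (K - n)) →
      divB (torusT (F.P K) 0) (fun κ z => unitsField (toUField W) ⟨z, κ⟩) (fun κ y => covD (torusT (F.P K) 0) (fun κ z => unitsField (toUField W) ⟨z, κ⟩) κ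
        (fun z => divB (torusT (F.P K) 0) (fun κ z => unitsField (toUField W) ⟨z, κ⟩)
          (fun ν w => covD (torusT (F.P K) 0) (fun κ z => unitsField (toUField W) ⟨z, κ⟩) ν ψ w) z) y) x = 0)
    (Fr : Site (F.P K) (K - n) → Site (F.P K) 0 → (Matrix (Fin 2) (Fin 2) ℂ)ˣ)
    (hFr : ∀ y z, ‖(Fr y z : Matrix (Fin 2) (Fin 2) ℂ)‖ ≤ 1 ∧ ‖(((Fr y z)⁻¹ : (Matrix (Fin 2) (Fin 2) ℂ)ˣ) : Matrix (Fin 2) (Fin 2) ℂ)‖ ≤ 1)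
    (hFr1 : ∀ y, Fr y (embIter (K - n) y) = 1)
    (c : Site (F.P K) (K - n) → Matrix (Fin 2) (Fin 2) ℂ) (hc : ∀ y (a : Matrix (Fin 2) (Fin 2) ℂ), Commute (c y) a) (a₀ a₁ : ℝ)
    (hA : ∀ (y : Site (F.P K) (K - n)) (z : Site (F.P K) 0),
      (∀ ν : Fin (F.P K).d,
        (y ν = (iterBlockOf (K - n) (fun κ => z κ - (((((F.P K).L ^ (K - n) - 1) / 2 : ℕ)) : ZMod ((F.P K).sitesPerDir 0)))) ν - 1
        ∨ y ν = (iterBlockOf (K - n) (fun κ => z κ - (((((F.P K).L ^ (K - n) - 1) / 2 : ℕ)) : ZMod ((F.P K).sitesPerDir 0)))) ν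
        ∨ y ν = (iterBlockOf (K - n) (fun κ => z κ - (((((F.P K).L ^ (K - n) - 1) / 2 : ℕ)) : ZMod ((F.P K).sitesPerDir 0)))) ν + 1
        ∨ y ν = (iterBlockOf (K - n) (fun κ => z κ - (((((F.P K).L ^ (K - n) - 1) / 2 : ℕ)) : ZMod ((F.P K).sitesPerDir 0)))) ν + 2)) →
      ∀ μ : Fin (F.P K).d,
        ‖(((Fr y z)⁻¹ * unitsField (toUField W) ⟨z, μ⟩ * Fr y (torusT (F.P K) 0 μ z) : (Matrix (Fin 2) (Fin 2) ℂ)ˣ) : Matrix (Fin 2) (Fin 2) ℂ) - 1‖ ≤ a₀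
        ∧ ‖(((Fr y ((torusT (F.P K) 0 μ).symm z))⁻¹ * unitsField (toUField W) ⟨(torusT (F.P K) 0 μ).symm z, μ⟩ * Fr y z : (Matrix (Fin 2) (Fin 2) ℂ)ˣ) :
            Matrix (Fin 2) (Fin 2) ℂ) - 1‖ ≤ a₀
        ∧ ‖(((Fr y z)⁻¹ * unitsField (toUField W) ⟨z, μ⟩ * Fr y (torusT (F.P K) 0 μ z) : (Matrix (Fin 2) (Fin 2) ℂ)ˣ) : Matrix (Fin 2) (Fin 2) ℂ)
            - (((Fr y ((torusT (F.P K) 0 μ).symm z))⁻¹ * unitsField (toUField W) ⟨(torusT (F.P K) 0 μ).symm z, μ⟩ * Fr y z : (Matrix (Fin 2) (Fin 2) ℂ)ˣ) :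
              Matrix (Fin 2) (Fin 2) ℂ)‖ ≤ a₁)
    (Z : Fin (F.P K).d → Site (F.P K) 0 → Matrix (Fin 2) (Fin 2) ℂ) (G : Site (F.P K) (K - n) → ℝ)
    (hG : ∀ (y : Site (F.P K) (K - n)) (z : Site (F.P K) 0),
      (∀ ν : Fin (F.P K).d,
        (y ν = (iterBlockOf (K - n) (fun κ => z κ - (((((F.P K).L ^ (K - n) - 1) / 2 : ℕ)) : ZMod ((F.P K).sitesPerDir 0)))) ν - 1
        ∨ y ν = (iterBlockOf (K - n) (fun κ => z κ - (((((F.P K).L ^ (K - n) - 1) / 2 : ℕ)) : ZMod ((F.P K).sitesPerDir 0)))) ν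
        ∨ y ν = (iterBlockOf (K - n) (fun κ => z κ - (((((F.P K).L ^ (K - n) - 1) / 2 : ℕ)) : ZMod ((F.P K).sitesPerDir 0)))) ν + 1
        ∨ y ν = (iterBlockOf (K - n) (fun κ => z κ - (((((F.P K).L ^ (K - n) - 1) / 2 : ℕ)) : ZMod ((F.P K).sitesPerDir 0)))) ν + 2)) →
      ∀ μ : Fin (F.P K).d, ‖R (Fr y z) (ψ (embIter (K - n) y)) - Z μ z‖ ≤ G y) :
    (F.L : ℝ) ^ (K - n) * ∑ x : Site (F.P K) 0, ∑ a : Fin 2, ∑ b : Fin 2,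
        Complex.normSq ((divB (torusT (F.P K) 0) (fun κ z => unitsField (toUField W) ⟨z, κ⟩)
          (fun κ y => covD (torusT (F.P K) 0) (fun κ z => unitsField (toUField W) ⟨z, κ⟩) κ ψ y) x) a b)
      ≤ (F.L : ℝ) ^ (K - n) * (2 * ((3 * (2 * ((F.P K).d : ℝ) * (a₁ + 2 * a₀ ^ 2)) ^ 2 * ((((F.P K).L ^ (K - n) : ℕ) : ℝ)) ^ (F.P K).d
          + 48 * ((F.P K).d : ℝ) ^ 2 * a₀ ^ 2 * (6 / ((((F.P K).L ^ (K - n) : ℕ) : ℝ)))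
            * (6 / ((((F.P K).L ^ (K - n) : ℕ) : ℝ)) * ((((F.P K).L ^ (K - n) : ℕ) : ℝ)) ^ (F.P K).d)) * ∑ y : Site (F.P K) (K - n), ‖ψ (embIter (K - n) y) - c y‖ ^ 2
        + 3 * ((F.P K).d : ℝ) ^ 2 * (24 / ((((F.P K).L ^ (K - n) : ℕ) : ℝ)) ^ 2)
            * (24 / ((((F.P K).L ^ (K - n) : ℕ) : ℝ)) ^ 2 * ((((F.P K).L ^ (K - n) : ℕ) : ℝ)) ^ (F.P K).d) * ∑ y : Site (F.P K) (K - n), G y ^ 2)) := by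
  obtain ⟨hp0, hpℓ, hp01, hpS, hpD, hpc, hpk⟩ := profile_rows (P := F.P K) (k := K - n) hℓ2
  have hU : ∀ (κ : Fin (F.P K).d) (z : Site (F.P K) 0), ‖((unitsField (toUField W) ⟨z, κ⟩ : (Matrix (Fin 2) (Fin 2) ℂ)ˣ) : Matrix (Fin 2) (Fin 2) ℂ)‖ ≤ 1
      ∧ ‖(((unitsField (toUField W) ⟨z, κ⟩)⁻¹ : (Matrix (Fin 2) (Fin 2) ℂ)ˣ) : Matrix (Fin 2) (Fin 2) ℂ)‖ ≤ 1 :=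
    fun κ z => bicontr_of_mem_unitary _ (unitsField_toUField_mem_unitary W κ z)
  obtain ⟨Φ, hΦ, hE⟩ := exists_extension_lap_energy_le (P := F.P K) (k := K - n) hk _ hp0 hpℓ hp01 hpS hpD hpc hpk
    (fun κ z => unitsField (toUField W) ⟨z, κ⟩) hU Fr hFr hFr1 (fun y => ψ (embIter (K - n) y)) c hc a₀ a₁ hA Z G hG
  refine lap_energy_le_of_extension_T3 F K n W ψ hψ ⟨Φ, hΦ, mul_le_mul_of_nonneg_left ?_ (by positivity)⟩
  calc ∑ x : Site (F.P K) 0, ∑ a : Fin 2, ∑ b : Fin 2, Complex.normSq ((divB (torusT (F.P K) 0) (fun κ z => unitsField (toUField W) ⟨z, κ⟩)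
          (fun κ y => covD (torusT (F.P K) 0) (fun κ z => unitsField (toUField W) ⟨z, κ⟩) κ Φ y) x) a b)
      ≤ ∑ x : Site (F.P K) 0, (2 : ℕ) * ‖divB (torusT (F.P K) 0) (fun κ z => unitsField (toUField W) ⟨z, κ⟩)
          (fun κ y => covD (torusT (F.P K) 0) (fun κ z => unitsField (toUField W) ⟨z, κ⟩) κ Φ y) x‖ ^ 2 :=
        Finset.sum_le_sum fun x _ => sum_normSq_le_mul_opNorm_sq _
    _ = 2 * ∑ x : Site (F.P K) 0, ‖divB (torusT (F.P K) 0) (fun κ z => unitsField (toUField W) ⟨z, κ⟩)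
          (fun μ => covD (torusT (F.P K) 0) (fun κ z => unitsField (toUField W) ⟨z, κ⟩) μ Φ) x‖ ^ 2 := by
        rw [Finset.mul_sum]; push_cast; rfl
    _ ≤ _ := mul_le_mul_of_nonneg_left hE (by norm_num)

end Assembly

end Summit.QuantumFields.YangMills.Theorems.Prop7LemmaHCurvedOfRows

end
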